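import Literature.NumberTheory.LFunctions.WeightedSumPlancherel
import HarnessLib

/-!
# Discrete mean values of Dirichlet polynomials with point-dependent smooth weights
# (Conrey–Iwaniec 2002, Lemma 5.3 and Proposition 5.4)

B. Conrey, H. Iwaniec, *Spacing of zeros of Hecke L-functions and the class number problem*,
Acta Arith. 103 (2002), §5 [held text `paper:arxiv-math_0111012`, p0013–p0014].

For a finite Dirichlet polynomial `D(τ) = Σ_{n ≤ N} a_n n^{−iτ}`, a finite set `𝒯` of
`δ`-separated real points and, FOR EACH POINT `t`, a weight `ω_t ∈ C¹(ℝ)` with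
`ω_t, ω_t′ ∈ L¹ ∩ L²`, `‖ω_t‖₂² + ‖ω_t′‖₂² ≤ c` (attached to `n` through `ω_t(log n)`):

* `weighted_discreteMeanValue` (**Lemma 5.3** with point-dependent weights): for `𝒯 ⊂ [−T, T]`,
  `T ≥ 1`: `Σ_t |Σ_{n ≤ N} a_n ω_t(log n) n^{−it}|² ≤ 8π · c · δ⁻¹ · (T + N) · Σ_n |a_n|²`;
* `weighted_discreteMeanValue_integral` (**Proposition 5.4** with point-dependent weights): for
  `𝒯 ⊂ [T, 2T]`, `T ≥ 2`:
  `Σ_t |…|² ≤ 180 · c · δ⁻¹ · (∫_{T/2}^{3T} |D(τ)|² dτ + Σ_n (1 + n/T)|a_n|²)`;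
* the `∃ C` forms `exists_weighted_discreteMeanValue`, `exists_weighted_discreteMeanValue_integral`
  (the registered stubs `stub_weighted_dmv`, `stub_weighted_dmv_integral` of the Conrey–Iwaniec
  Proposition 8.1 line, cell landau-siegel / ls-inputs, VERBATIM).

Proof: Lemma 5.1 at each point (`WeightedSumPlancherel.lean`), the Poisson-weight density of the
points (`≤ (4π/δ)(1+τ²/(2T+2)²)^{−1}`, resp. `≤ (2π/δ)𝟙_{[T/2,3T]} + (120/(δT))(1+τ²/T²)^{−1}`), and
the Cauchy-kernel mean value (5.15) (`DirichletPolynomialCauchyMeanValue.lean`).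
WHY point-dependent weights: in §8 of the paper the weights are `w_s(n)V_s(n/Q)`, `v_s(n/Q)`
((7.21)–(7.23)), which depend on the point `s`; they cost only `sup_s (‖ω_s‖₂² + ‖ω_s′‖₂²)`, while
the coefficients `a_n` stay fixed, so the main term `∫_{T/2}^{3T}|D|²` can be evaluated by an
off-diagonal analysis (Proposition 6.4). Everything PROVED; no definition.

«The programme SEARCHES and TYPES; no claim about Landau–Siegel zeros until a kernel theorem says so.»

## References
* [ConreyIwaniec2002] B. Conrey, H. Iwaniec, Acta Arith. 103 (2002) 259–312, arXiv:math/0111012: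
  §5, Lemma 5.1 (5.3)–(5.4), Corollary 5.2 (5.5), (5.10)–(5.16), Lemma 5.3 (5.17),
  Proposition 5.4 (5.18)–(5.19).
-/

noncomputable section

open Complex MeasureTheory Filter Set Finset Real FourierTransform
open scoped Topology Real

namespace Literature.NumberTheory.LFunctions

namespace WeightedMeanValue

open Gallagher (phase norm_phase continuous_phase natCast_cpow_eq_phase)

/-! ## §4. Lemma 5.3 with point-dependent weights -/

/-- Summing Lemma 5.1 over the points: `Σ_t |Σ_n a_n ω_t(log n) n^{−it}|² ≤ (c/2π) ∫ |D(τ)|² G(τ) dτ`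
with `G(τ) = Σ_t (1 + (τ − t)²)^{−1}`. [cite: ConreyIwaniec2002, §5 (5.11)] -/
theorem sum_norm_sq_weightedSum_le (N : ℕ) (a : ℕ → ℂ) {c : ℝ} (𝒯 : Finset ℝ) (ω : ℝ → ℝ → ℂ)
    (hω : ∀ t ∈ 𝒯, Differentiable ℝ (ω t) ∧ Integrable (ω t) ∧ Integrable (deriv (ω t)) ∧
      MemLp (ω t) 2 ∧ MemLp (deriv (ω t)) 2 ∧
      (∫ y : ℝ, ‖ω t y‖ ^ 2) + (∫ y : ℝ, ‖deriv (ω t) y‖ ^ 2) ≤ c) :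
    ∑ t ∈ 𝒯, ‖∑ n ∈ Finset.Icc 1 N, a n * ω t (Real.log n) * (n : ℂ) ^ (-((t : ℂ) * I))‖ ^ 2 ≤
      c / (2 * π) * ∫ τ : ℝ, ‖∑ n ∈ Finset.Icc 1 N, a n * (n : ℂ) ^ (-((τ : ℂ) * I))‖ ^ 2 *
        ∑ t ∈ 𝒯, (1 + (τ - t) ^ 2)⁻¹ := by
  set D : ℝ → ℂ := fun τ => ∑ n ∈ Finset.Icc 1 N, a n * (n : ℂ) ^ (-((τ : ℂ) * I)) with hD
  have hterm : ∀ t ∈ 𝒯,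
      ‖∑ n ∈ Finset.Icc 1 N, a n * ω t (Real.log n) * (n : ℂ) ^ (-((t : ℂ) * I))‖ ^ 2 ≤
        c / (2 * π) * ∫ τ : ℝ, ‖D τ‖ ^ 2 * (1 + (τ - t) ^ 2)⁻¹ := by
    intro t ht
    obtain ⟨hd, hi, hi', h2, h2', hc⟩ := hω t ht
    exact norm_sq_weightedSum_le hd hi hi' h2 h2' hc a N t
  refine (Finset.sum_le_sum hterm).trans (le_of_eq ?_)
  rw [← Finset.mul_sum]
  congr 1
  rw [← integral_finsetSum]
  · refine integral_congr_ae (Eventually.of_forall fun τ => ?_)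
    simp only [hD, Finset.mul_sum]
  · intro t _
    exact integrable_norm_sq_dpoly_mul_inv a N t
where
  /-- each `|D(τ)|² (1 + (τ−t)²)^{−1}` is integrable -/
  integrable_norm_sq_dpoly_mul_inv (a : ℕ → ℂ) (N : ℕ) (t : ℝ) :
      Integrable fun τ : ℝ =>
        ‖∑ n ∈ Finset.Icc 1 N, a n * (n : ℂ) ^ (-((τ : ℂ) * I))‖ ^ 2 * (1 + (τ - t) ^ 2)⁻¹ := by
    have hk : Integrable fun τ : ℝ => (1 + (τ - t) ^ 2)⁻¹ :=
      integrable_inv_one_add_sq.comp_sub_right t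
    refine (hk.const_mul ((∑ n ∈ Finset.Icc 1 N, ‖a n‖) ^ 2)).mono'
      (((continuous_dpoly a N).norm.pow 2).mul (continuous_inv_one_add_sq_sub' t)).aestronglyMeasurable
      (Eventually.of_forall fun τ => ?_)
    rw [Real.norm_of_nonneg (by positivity)]
    gcongr
    exact norm_dpoly_le a N τ

/-- `|D(τ)|² (1 + τ²/T²)^{−1}` is integrable (the integrand of (5.15)).
[cite: ConreyIwaniec2002, §5 (5.15)] -/
theorem integrable_norm_sq_dpoly_mul_cauchy (a : ℕ → ℂ) (N : ℕ) {T : ℝ} (hT : 0 < T) :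
    Integrable fun τ : ℝ =>
      ‖∑ n ∈ Finset.Icc 1 N, a n * (n : ℂ) ^ (-((τ : ℂ) * I))‖ ^ 2 * (1 + τ ^ 2 / T ^ 2)⁻¹ := by
  refine ((integrable_cauchyKernel hT).const_mul ((∑ n ∈ Finset.Icc 1 N, ‖a n‖) ^ 2)).mono'
    (((continuous_dpoly a N).norm.pow 2).mul (continuous_cauchyKernel T)).aestronglyMeasurable
    (Eventually.of_forall fun τ => ?_)
  rw [Real.norm_of_nonneg (by positivity)]
  gcongr
  exact norm_dpoly_le a N τ

/-- **The Poisson-weight density for points in `[−T, T]`**: for `δ`-separated `𝒯 ⊂ [−T, T]`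
(`0 < δ ≤ 1`, `T ≥ 0`), `Σ_{t∈𝒯} (1+(τ−t)²)^{−1} ≤ (4π/δ)(1 + τ²/(2T+2)²)^{−1}` for all `τ`.
[cite: ConreyIwaniec2002, §5 (5.11)–(5.12)] -/
theorem sum_inv_one_add_sq_le_cauchy {δ T : ℝ} (hδ : 0 < δ) (hδ1 : δ ≤ 1) (hT : 0 ≤ T)
    (𝒯 : Finset ℝ) (hmem : ∀ t ∈ 𝒯, |t| ≤ T)
    (hsep : ∀ t ∈ 𝒯, ∀ t' ∈ 𝒯, t ≠ t' → δ ≤ |t - t'|) (τ : ℝ) :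
    ∑ t ∈ 𝒯, (1 + (τ - t) ^ 2)⁻¹ ≤ (4 * π / δ) * (1 + τ ^ 2 / (2 * T + 2) ^ 2)⁻¹ := by
  have h1 := sum_inv_one_add_sq_le hδ hδ1 𝒯 (X₁ := -T) (X₂ := T) (by linarith)
    (fun t ht => abs_le.mp (hmem t ht)) hsep τ
  refine h1.trans ?_
  set T' : ℝ := 2 * T + 2 with hT'
  have hT'0 : 0 < T' := by positivity
  have hAB : -T - δ / 2 ≤ T + δ / 2 := by linarith
  -- the window integral is `≤ 2π (1 + τ²/T'²)^{-1}`
  have hg : ∫ u in (-T - δ / 2)..(T + δ / 2), (1 + (τ - u) ^ 2)⁻¹ ≤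
      2 * π * (1 + τ ^ 2 / T' ^ 2)⁻¹ := by
    rcases le_or_gt |τ| T' with hτ | hτ
    · -- near: `g ≤ π ≤ 2π · 1/2 ≤ 2π (1+τ²/T'²)⁻¹`
      have hpi := intervalIntegral_inv_one_add_sq_le_pi τ _ _ hAB
      have hhalf : (1 : ℝ) / 2 ≤ (1 + τ ^ 2 / T' ^ 2)⁻¹ := by
        rw [one_div, inv_le_inv₀ (by norm_num) (by positivity)]
        have : τ ^ 2 ≤ T' ^ 2 := by
          rw [← sq_abs τ]; exact pow_le_pow_left₀ (abs_nonneg τ) hτ 2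
        have : τ ^ 2 / T' ^ 2 ≤ 1 := by rw [div_le_one (by positivity)]; exact this
        linarith
      nlinarith [Real.pi_pos]
    · -- far: `|τ − u| ≥ |τ|/2` on the window
      have hfar : ∀ u ∈ Set.Icc (-T - δ / 2) (T + δ / 2), |τ| / 2 ≤ |τ - u| := by
        intro u hu
        have hu' : |u| ≤ T + 1 / 2 := by rw [abs_le]; constructor <;> linarith [hu.1, hu.2]
        have h1 : |τ| - |u| ≤ |τ - u| := abs_sub_abs_le_abs_sub τ u
        have : |τ| / 2 ≥ T + 1 := by rw [hT'] at hτ; linarith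
        linarith
      have hI := intervalIntegral_inv_one_add_sq_le_of_dist hAB (by positivity : 0 ≤ |τ| / 2) hfar
      refine hI.trans ?_
      have hlen : T + δ / 2 - (-T - δ / 2) = 2 * T + δ := by ring
      rw [hlen]
      -- `(2T+δ)/(1+τ²/4) ≤ 2π T'²/(T'² + τ²)`
      have hτ2 : T' ^ 2 ≤ τ ^ 2 := by
        rw [← sq_abs τ]; exact pow_le_pow_left₀ hT'0.le hτ.le 2
      rw [div_le_iff₀ (by positivity)]
      have e1 : 2 * π * (1 + τ ^ 2 / T' ^ 2)⁻¹ * (1 + (|τ| / 2) ^ 2) =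
          2 * π * T' ^ 2 * (1 + τ ^ 2 / 4) / (T' ^ 2 + τ ^ 2) := by
        rw [div_pow, sq_abs]
        field_simp
        ring
      rw [e1, le_div_iff₀ (by positivity)]
      -- `(2T+δ)(T'²+τ²) ≤ (2T+1)·2τ² ≤ (π/2)T'²τ² ≤ 2π T'² (1+τ²/4)`
      have hπ3 : (3 : ℝ) ≤ π := by linarith [Real.pi_gt_three]
      have hδ' : 2 * T + δ ≤ 2 * T + 1 := by linarith
      have k1 : (2 * T + δ) * (T' ^ 2 + τ ^ 2) ≤ (2 * T + 1) * (2 * τ ^ 2) :=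
        mul_le_mul hδ' (by linarith [hτ2]) (by positivity) (by linarith)
      have k2a : 4 * T + 2 ≤ π / 2 * T' ^ 2 := by
        rw [hT']; nlinarith [hπ3, sq_nonneg (T + 1)]
      have k2 : (2 * T + 1) * (2 * τ ^ 2) ≤ 2 * π * T' ^ 2 * (1 + τ ^ 2 / 4) := by
        have h1 : (2 * T + 1) * (2 * τ ^ 2) = (4 * T + 2) * τ ^ 2 := by ring
        have h2 : 2 * π * T' ^ 2 * (1 + τ ^ 2 / 4) = 2 * π * T' ^ 2 + π / 2 * T' ^ 2 * τ ^ 2 := by ring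
        rw [h1, h2]
        have h3 := mul_le_mul_of_nonneg_right k2a (sq_nonneg τ)
        have h4 : 0 ≤ 2 * π * T' ^ 2 := by positivity
        linarith
      linarith
  calc 2 / δ * ∫ u in (-T - δ / 2)..(T + δ / 2), (1 + (τ - u) ^ 2)⁻¹
      ≤ 2 / δ * (2 * π * (1 + τ ^ 2 / T' ^ 2)⁻¹) := mul_le_mul_of_nonneg_left hg (by positivity)
    _ = 4 * π / δ * (1 + τ ^ 2 / (2 * T + 2) ^ 2)⁻¹ := by rw [hT']; ring

/-- **Lemma 5.3 (Conrey–Iwaniec) with point-dependent weights.** Let `𝒯 ⊂ [−T, T]` (`T ≥ 1`) be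
`δ`-separated (`0 < δ ≤ 1`), and for each `t ∈ 𝒯` let `ω_t ∈ C¹(ℝ)` with `ω_t, ω_t′ ∈ L¹ ∩ L²` and
`‖ω_t‖₂² + ‖ω_t′‖₂² ≤ c`. Then for all coefficients `a_n`,
`Σ_{t∈𝒯} |Σ_{n≤N} a_n ω_t(log n) n^{−it}|² ≤ 8π · c · δ⁻¹ · (T + N) · Σ_{n≤N} |a_n|²`.
[cite: ConreyIwaniec2002, Lemma 5.3 (5.17)] -/
theorem weighted_discreteMeanValue (N : ℕ) (a : ℕ → ℂ) {T δ c : ℝ} (𝒯 : Finset ℝ)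
    (ω : ℝ → ℝ → ℂ) (hT : 1 ≤ T) (hδ : 0 < δ) (hδ1 : δ ≤ 1) (hc : 0 ≤ c)
    (hmem : ∀ t ∈ 𝒯, |t| ≤ T) (hsep : ∀ t ∈ 𝒯, ∀ t' ∈ 𝒯, t ≠ t' → δ ≤ |t - t'|)
    (hω : ∀ t ∈ 𝒯, Differentiable ℝ (ω t) ∧ Integrable (ω t) ∧ Integrable (deriv (ω t)) ∧
      MemLp (ω t) 2 ∧ MemLp (deriv (ω t)) 2 ∧
      (∫ y : ℝ, ‖ω t y‖ ^ 2) + (∫ y : ℝ, ‖deriv (ω t) y‖ ^ 2) ≤ c) :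
    ∑ t ∈ 𝒯, ‖∑ n ∈ Finset.Icc 1 N, a n * ω t (Real.log n) * (n : ℂ) ^ (-((t : ℂ) * I))‖ ^ 2 ≤
      8 * π * c * δ⁻¹ * (T + N) * ∑ n ∈ Finset.Icc 1 N, ‖a n‖ ^ 2 := by
  have h1 := sum_norm_sq_weightedSum_le N a 𝒯 ω hω
  refine h1.trans ?_
  set D : ℝ → ℂ := fun τ => ∑ n ∈ Finset.Icc 1 N, a n * (n : ℂ) ^ (-((τ : ℂ) * I)) with hD
  set T' : ℝ := 2 * T + 2 with hT'
  have hT'2 : 2 ≤ T' := by rw [hT']; linarith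
  have hT'0 : 0 < T' := by linarith
  -- `∫ |D|² G ≤ (4π/δ) ∫ |D|² (1+τ²/T'²)⁻¹ ≤ (4π/δ) π Σ (T' + 3n)|a_n|²`
  have hG : ∀ τ, ∑ t ∈ 𝒯, (1 + (τ - t) ^ 2)⁻¹ ≤ (4 * π / δ) * (1 + τ ^ 2 / T' ^ 2)⁻¹ :=
    fun τ => sum_inv_one_add_sq_le_cauchy hδ hδ1 (by linarith) 𝒯 hmem hsep τ
  have hint1 : Integrable fun τ : ℝ => ‖D τ‖ ^ 2 * ∑ t ∈ 𝒯, (1 + (τ - t) ^ 2)⁻¹ := by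
    have : (fun τ : ℝ => ‖D τ‖ ^ 2 * ∑ t ∈ 𝒯, (1 + (τ - t) ^ 2)⁻¹) =
        fun τ => ∑ t ∈ 𝒯, ‖D τ‖ ^ 2 * (1 + (τ - t) ^ 2)⁻¹ := by
      funext τ; rw [Finset.mul_sum]
    rw [this]
    exact integrable_finsetSum _ fun t _ =>
      sum_norm_sq_weightedSum_le.integrable_norm_sq_dpoly_mul_inv a N t
  have hint2 := integrable_norm_sq_dpoly_mul_cauchy a N hT'0
  have hI : ∫ τ : ℝ, ‖D τ‖ ^ 2 * ∑ t ∈ 𝒯, (1 + (τ - t) ^ 2)⁻¹ ≤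
      (4 * π / δ) * (π * ∑ n ∈ Finset.Icc 1 N, (T' + 3 * n) * ‖a n‖ ^ 2) := by
    calc ∫ τ : ℝ, ‖D τ‖ ^ 2 * ∑ t ∈ 𝒯, (1 + (τ - t) ^ 2)⁻¹
        ≤ ∫ τ : ℝ, (4 * π / δ) * (‖D τ‖ ^ 2 * (1 + τ ^ 2 / T' ^ 2)⁻¹) := by
          refine integral_mono hint1 (hint2.const_mul _) fun τ => ?_
          have := hG τ
          have h0 : 0 ≤ ‖D τ‖ ^ 2 := by positivity
          nlinarith
      _ = (4 * π / δ) * ∫ τ : ℝ, ‖D τ‖ ^ 2 * (1 + τ ^ 2 / T' ^ 2)⁻¹ := integral_const_mul _ _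
      _ ≤ (4 * π / δ) * (π * ∑ n ∈ Finset.Icc 1 N, (T' + 3 * n) * ‖a n‖ ^ 2) :=
          mul_le_mul_of_nonneg_left (integral_norm_sq_dpoly_cauchy_le a N hT'2) (by positivity)
  -- `Σ (T' + 3n)|a_n|² ≤ (4T + 3N) Σ |a_n|² ≤ 4(T+N) Σ|a_n|²`
  have hS : ∑ n ∈ Finset.Icc 1 N, (T' + 3 * n) * ‖a n‖ ^ 2 ≤
      4 * (T + N) * ∑ n ∈ Finset.Icc 1 N, ‖a n‖ ^ 2 := by
    rw [Finset.mul_sum]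
    refine Finset.sum_le_sum fun n hn => ?_
    rw [Finset.mem_Icc] at hn
    have hnN : (n : ℝ) ≤ N := by exact_mod_cast hn.2
    have : T' + 3 * n ≤ 4 * (T + N) := by rw [hT']; linarith
    exact mul_le_mul_of_nonneg_right this (sq_nonneg _)
  have hsum0 : 0 ≤ ∑ n ∈ Finset.Icc 1 N, ‖a n‖ ^ 2 := Finset.sum_nonneg fun _ _ => sq_nonneg _
  calc c / (2 * π) * ∫ τ : ℝ, ‖D τ‖ ^ 2 * ∑ t ∈ 𝒯, (1 + (τ - t) ^ 2)⁻¹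
      ≤ c / (2 * π) * ((4 * π / δ) * (π * (4 * (T + N) * ∑ n ∈ Finset.Icc 1 N, ‖a n‖ ^ 2))) := by
        refine mul_le_mul_of_nonneg_left (hI.trans ?_) (by positivity)
        gcongr
    _ = 8 * π * c * δ⁻¹ * (T + N) * ∑ n ∈ Finset.Icc 1 N, ‖a n‖ ^ 2 := by
        field_simp
        ring

/-- **Lemma 5.3 with point-dependent weights, `∃ C` form** (the registered stub `stub_weighted_dmv`
of the Conrey–Iwaniec Proposition 8.1 line). [cite: ConreyIwaniec2002, Lemma 5.3 (5.17)] -/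
theorem exists_weighted_discreteMeanValue :
    ∃ C : ℝ, 0 < C ∧
    ∀ (N : ℕ) (a : ℕ → ℂ) (T δ c : ℝ) (𝒯 : Finset ℝ) (ω : ℝ → ℝ → ℂ),
      1 ≤ T → 0 < δ → δ ≤ 1 → 0 ≤ c →
      (∀ t ∈ 𝒯, |t| ≤ T) → (∀ t ∈ 𝒯, ∀ t' ∈ 𝒯, t ≠ t' → δ ≤ |t - t'|) →
      (∀ t ∈ 𝒯, Differentiable ℝ (ω t) ∧ Integrable (ω t) ∧ Integrable (deriv (ω t)) ∧
        MemLp (ω t) 2 ∧ MemLp (deriv (ω t)) 2 ∧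
        (∫ y : ℝ, ‖ω t y‖ ^ 2) + (∫ y : ℝ, ‖deriv (ω t) y‖ ^ 2) ≤ c) →
      ∑ t ∈ 𝒯, ‖∑ n ∈ Finset.Icc 1 N, a n * ω t (Real.log n) * (n : ℂ) ^ (-((t : ℂ) * I))‖ ^ 2 ≤
        C * c * δ⁻¹ * (T + N) * ∑ n ∈ Finset.Icc 1 N, ‖a n‖ ^ 2 :=
  ⟨8 * π, by positivity, fun N a T δ c 𝒯 ω hT hδ hδ1 hc hmem hsep hω =>
    weighted_discreteMeanValue N a 𝒯 ω hT hδ hδ1 hc hmem hsep hω⟩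

/-! ## §5. Proposition 5.4 with point-dependent weights (points in `[T, 2T]`) -/

/-- **The Poisson-weight density for points in `[T, 2T]`**: for `δ`-separated `𝒯 ⊂ [T, 2T]`
(`0 < δ ≤ 1`, `T ≥ 2`) and all `τ`,
`Σ_{t∈𝒯} (1+(τ−t)²)^{−1} ≤ (2π/δ)·𝟙_{[T/2,3T]}(τ) + (120/(δT))(1 + τ²/T²)^{−1}`
(outside `[T/2, 3T]` the window `[T−δ/2, 2T+δ/2]` is at distance `≥ (T−τ)/2` resp. `(τ−2T)/2`,
and `(T−τ)² ≥ (T²+τ²)/8`, `(τ−2T)² ≥ (T²+τ²)/10`). [cite: ConreyIwaniec2002, §5 (5.12)] -/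
theorem sum_inv_one_add_sq_le_dyadic {δ T : ℝ} (hδ : 0 < δ) (hδ1 : δ ≤ 1) (hT : 2 ≤ T)
    (𝒯 : Finset ℝ) (hmem : ∀ t ∈ 𝒯, T ≤ t ∧ t ≤ 2 * T)
    (hsep : ∀ t ∈ 𝒯, ∀ t' ∈ 𝒯, t ≠ t' → δ ≤ |t - t'|) (τ : ℝ) :
    ∑ t ∈ 𝒯, (1 + (τ - t) ^ 2)⁻¹ ≤
      (2 * π / δ) * Set.indicator (Set.Icc (T / 2) (3 * T)) (fun _ => (1 : ℝ)) τ +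
        (120 / (δ * T)) * (1 + τ ^ 2 / T ^ 2)⁻¹ := by
  have hT0 : 0 < T := by linarith
  have hAB : T - δ / 2 ≤ 2 * T + δ / 2 := by linarith
  have h1 := sum_inv_one_add_sq_le hδ hδ1 𝒯 (X₁ := T) (X₂ := 2 * T) (by linarith) hmem hsep τ
  refine h1.trans ?_
  have hsecond0 : 0 ≤ (120 / (δ * T)) * (1 + τ ^ 2 / T ^ 2)⁻¹ := by positivity
  have hfirst0 : 0 ≤ (2 * π / δ) * Set.indicator (Set.Icc (T / 2) (3 * T)) (fun _ => (1 : ℝ)) τ := by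
    apply mul_nonneg (by positivity)
    exact Set.indicator_nonneg (fun _ _ => zero_le_one) _
  by_cases hin : τ ∈ Set.Icc (T / 2) (3 * T)
  · -- inside: `≤ (2/δ) π`
    rw [Set.indicator_of_mem hin, mul_one]
    have hpi := intervalIntegral_inv_one_add_sq_le_pi τ _ _ hAB
    calc 2 / δ * ∫ u in (T - δ / 2)..(2 * T + δ / 2), (1 + (τ - u) ^ 2)⁻¹ ≤ 2 / δ * π :=
          mul_le_mul_of_nonneg_left hpi (by positivity)
      _ = 2 * π / δ := by ring
      _ ≤ _ := le_add_of_nonneg_right hsecond0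
  · rw [Set.indicator_of_notMem hin, mul_zero, zero_add]
    rw [Set.mem_Icc, not_and_or, not_le, not_le] at hin
    -- in both far cases the window integral is `≤ 60 T/(T²+τ²)`
    have hg : ∫ u in (T - δ / 2)..(2 * T + δ / 2), (1 + (τ - u) ^ 2)⁻¹ ≤ 60 * T / (T ^ 2 + τ ^ 2) := by
      have hlen : 2 * T + δ / 2 - (T - δ / 2) = T + δ := by ring
      rcases hin with hlo | hhi
      · -- `τ < T/2`: distance `≥ (T − τ)/2`
        have hd0 : 0 ≤ (T - τ) / 2 := by linarith
        have hfar : ∀ u ∈ Set.Icc (T - δ / 2) (2 * T + δ / 2), (T - τ) / 2 ≤ |τ - u| := by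
          intro u hu
          have hu1 : T - 1 / 2 ≤ u := by linarith [hu.1]
          have hpos : 0 ≤ u - τ := by linarith
          rw [abs_sub_comm, abs_of_nonneg hpos]
          linarith
        have hI := intervalIntegral_inv_one_add_sq_le_of_dist hAB hd0 hfar
        rw [hlen] at hI
        refine hI.trans ?_
        set d : ℝ := (T - τ) / 2 with hd
        have hsq : T ^ 2 + τ ^ 2 ≤ 32 * d ^ 2 := by
          rcases le_or_gt τ 0 with hτ0 | hτ0
          · have : 0 ≤ T * (-τ) := mul_nonneg hT0.le (by linarith)
            nlinarith [sq_nonneg (T - τ)]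
          · have hge : T / 2 ≤ T - τ := by linarith
            have h4 : (T / 2) * (T / 2) ≤ (T - τ) * (T - τ) :=
              mul_self_le_mul_self (by linarith) hge
            have hτT : τ * τ ≤ (T / 2) * (T / 2) := mul_self_le_mul_self hτ0.le (by linarith)
            nlinarith
        rw [div_le_div_iff₀ (by positivity) (by positivity)]
        have hδT : T + δ ≤ 3 / 2 * T := by linarith
        have k1 : (T + δ) * (T ^ 2 + τ ^ 2) ≤ (3 / 2 * T) * (32 * d ^ 2) :=
          mul_le_mul hδT hsq (by positivity) (by positivity)
        have k2 : 0 ≤ T * d ^ 2 := by positivity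
        nlinarith [k1, k2]
      · -- `τ > 3T`: distance `≥ (τ − 2T)/2`
        have hd0 : 0 ≤ (τ - 2 * T) / 2 := by linarith
        have hfar : ∀ u ∈ Set.Icc (T - δ / 2) (2 * T + δ / 2), (τ - 2 * T) / 2 ≤ |τ - u| := by
          intro u hu
          have hu2 : u ≤ 2 * T + 1 / 2 := by linarith [hu.2]
          have hpos : 0 ≤ τ - u := by linarith
          rw [abs_of_nonneg hpos]
          linarith
        have hI := intervalIntegral_inv_one_add_sq_le_of_dist hAB hd0 hfar
        rw [hlen] at hI
        refine hI.trans ?_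
        set d : ℝ := (τ - 2 * T) / 2 with hd
        have hsq : T ^ 2 + τ ^ 2 ≤ 40 * d ^ 2 := by
          have hge : τ / 3 ≤ τ - 2 * T := by linarith
          have h9 : (τ / 3) * (τ / 3) ≤ (τ - 2 * T) * (τ - 2 * T) :=
            mul_self_le_mul_self (by linarith) hge
          have hTτ : T * T ≤ (τ / 3) * (τ / 3) := mul_self_le_mul_self hT0.le (by linarith)
          nlinarith
        rw [div_le_div_iff₀ (by positivity) (by positivity)]
        have hδT : T + δ ≤ 3 / 2 * T := by linarith
        have k1 : (T + δ) * (T ^ 2 + τ ^ 2) ≤ (3 / 2 * T) * (40 * d ^ 2) :=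
          mul_le_mul hδT hsq (by positivity) (by positivity)
        have k2 : 0 ≤ T * d ^ 2 := by positivity
        nlinarith [k1, k2]
    calc 2 / δ * ∫ u in (T - δ / 2)..(2 * T + δ / 2), (1 + (τ - u) ^ 2)⁻¹
        ≤ 2 / δ * (60 * T / (T ^ 2 + τ ^ 2)) := mul_le_mul_of_nonneg_left hg (by positivity)
      _ = 120 / (δ * T) * (1 + τ ^ 2 / T ^ 2)⁻¹ := by
          field_simp
          ring

/-- **Proposition 5.4 (Conrey–Iwaniec) with point-dependent weights.** Let `𝒯 ⊂ [T, 2T]`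
(`T ≥ 2`) be `δ`-separated (`0 < δ ≤ 1`) and the weights `ω_t` as in Lemma 5.3 with
`‖ω_t‖₂² + ‖ω_t′‖₂² ≤ c`. Then
`Σ_t |Σ_{n≤N} a_n ω_t(log n) n^{−it}|² ≤ 180·c·δ⁻¹·(∫_{T/2}^{3T} |Σ a_n n^{−iτ}|² dτ + Σ (1 + n/T)|a_n|²)`
— the main term is kept as an integral (to be evaluated by an off-diagonal analysis when the
coefficients range beyond `T`). [cite: ConreyIwaniec2002, Proposition 5.4 (5.19)] -/
theorem weighted_discreteMeanValue_integral (N : ℕ) (a : ℕ → ℂ) {T δ c : ℝ} (𝒯 : Finset ℝ)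
    (ω : ℝ → ℝ → ℂ) (hT : 2 ≤ T) (hδ : 0 < δ) (hδ1 : δ ≤ 1) (hc : 0 ≤ c)
    (hmem : ∀ t ∈ 𝒯, T ≤ t ∧ t ≤ 2 * T) (hsep : ∀ t ∈ 𝒯, ∀ t' ∈ 𝒯, t ≠ t' → δ ≤ |t - t'|)
    (hω : ∀ t ∈ 𝒯, Differentiable ℝ (ω t) ∧ Integrable (ω t) ∧ Integrable (deriv (ω t)) ∧
      MemLp (ω t) 2 ∧ MemLp (deriv (ω t)) 2 ∧
      (∫ y : ℝ, ‖ω t y‖ ^ 2) + (∫ y : ℝ, ‖deriv (ω t) y‖ ^ 2) ≤ c) :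
    ∑ t ∈ 𝒯, ‖∑ n ∈ Finset.Icc 1 N, a n * ω t (Real.log n) * (n : ℂ) ^ (-((t : ℂ) * I))‖ ^ 2 ≤
      180 * c * δ⁻¹ *
        ((∫ τ in (T / 2)..(3 * T), ‖∑ n ∈ Finset.Icc 1 N, a n * (n : ℂ) ^ (-((τ : ℂ) * I))‖ ^ 2) +
          ∑ n ∈ Finset.Icc 1 N, (1 + n / T) * ‖a n‖ ^ 2) := by
  have hT0 : 0 < T := by linarith
  have h1 := sum_norm_sq_weightedSum_le N a 𝒯 ω hω
  refine h1.trans ?_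
  set D : ℝ → ℂ := fun τ => ∑ n ∈ Finset.Icc 1 N, a n * (n : ℂ) ^ (-((τ : ℂ) * I)) with hD
  set M : ℝ → ℝ := fun τ => (2 * π / δ) * Set.indicator (Set.Icc (T / 2) (3 * T)) (fun _ => (1 : ℝ)) τ +
    (120 / (δ * T)) * (1 + τ ^ 2 / T ^ 2)⁻¹ with hM
  have hG : ∀ τ, ∑ t ∈ 𝒯, (1 + (τ - t) ^ 2)⁻¹ ≤ M τ :=
    fun τ => sum_inv_one_add_sq_le_dyadic hδ hδ1 hT 𝒯 hmem hsep τ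
  have hint1 : Integrable fun τ : ℝ => ‖D τ‖ ^ 2 * ∑ t ∈ 𝒯, (1 + (τ - t) ^ 2)⁻¹ := by
    have : (fun τ : ℝ => ‖D τ‖ ^ 2 * ∑ t ∈ 𝒯, (1 + (τ - t) ^ 2)⁻¹) =
        fun τ => ∑ t ∈ 𝒯, ‖D τ‖ ^ 2 * (1 + (τ - t) ^ 2)⁻¹ := by
      funext τ; rw [Finset.mul_sum]
    rw [this]
    exact integrable_finsetSum _ fun t _ =>
      sum_norm_sq_weightedSum_le.integrable_norm_sq_dpoly_mul_inv a N t
  -- the two pieces of `|D|² M`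
  have hpieceA : Integrable fun τ : ℝ =>
      ‖D τ‖ ^ 2 * Set.indicator (Set.Icc (T / 2) (3 * T)) (fun _ => (1 : ℝ)) τ := by
    have : (fun τ : ℝ => ‖D τ‖ ^ 2 * Set.indicator (Set.Icc (T / 2) (3 * T)) (fun _ => (1 : ℝ)) τ)
        = Set.indicator (Set.Icc (T / 2) (3 * T)) (fun τ => ‖D τ‖ ^ 2) := by
      funext τ
      by_cases h : τ ∈ Set.Icc (T / 2) (3 * T)
      · rw [Set.indicator_of_mem h, Set.indicator_of_mem h, mul_one]
      · rw [Set.indicator_of_notMem h, Set.indicator_of_notMem h, mul_zero]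
    rw [this, integrable_indicator_iff measurableSet_Icc]
    exact ((continuous_dpoly a N).norm.pow 2).continuousOn.integrableOn_compact isCompact_Icc
  have hpieceB := integrable_norm_sq_dpoly_mul_cauchy a N hT0
  have hintM : Integrable fun τ : ℝ => ‖D τ‖ ^ 2 * M τ := by
    have : (fun τ : ℝ => ‖D τ‖ ^ 2 * M τ) = fun τ =>
        (2 * π / δ) * (‖D τ‖ ^ 2 * Set.indicator (Set.Icc (T / 2) (3 * T)) (fun _ => (1 : ℝ)) τ) +
        (120 / (δ * T)) * (‖D τ‖ ^ 2 * (1 + τ ^ 2 / T ^ 2)⁻¹) := by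
      funext τ; simp only [hM]; ring
    rw [this]
    exact (hpieceA.const_mul _).add (hpieceB.const_mul _)
  -- `∫ |D|² 𝟙 = ∫_{T/2}^{3T} |D|²`
  have hA : ∫ τ : ℝ, ‖D τ‖ ^ 2 * Set.indicator (Set.Icc (T / 2) (3 * T)) (fun _ => (1 : ℝ)) τ =
      ∫ τ in (T / 2)..(3 * T), ‖D τ‖ ^ 2 := by
    have : (fun τ : ℝ => ‖D τ‖ ^ 2 * Set.indicator (Set.Icc (T / 2) (3 * T)) (fun _ => (1 : ℝ)) τ)
        = Set.indicator (Set.Icc (T / 2) (3 * T)) (fun τ => ‖D τ‖ ^ 2) := by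
      funext τ
      by_cases h : τ ∈ Set.Icc (T / 2) (3 * T)
      · rw [Set.indicator_of_mem h, Set.indicator_of_mem h, mul_one]
      · rw [Set.indicator_of_notMem h, Set.indicator_of_notMem h, mul_zero]
    rw [this, integral_indicator measurableSet_Icc, intervalIntegral.integral_of_le (by linarith),
      integral_Icc_eq_integral_Ioc]
  have hI : ∫ τ : ℝ, ‖D τ‖ ^ 2 * ∑ t ∈ 𝒯, (1 + (τ - t) ^ 2)⁻¹ ≤
      (2 * π / δ) * (∫ τ in (T / 2)..(3 * T), ‖D τ‖ ^ 2) +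
        (120 / (δ * T)) * (π * ∑ n ∈ Finset.Icc 1 N, (T + 3 * n) * ‖a n‖ ^ 2) := by
    calc ∫ τ : ℝ, ‖D τ‖ ^ 2 * ∑ t ∈ 𝒯, (1 + (τ - t) ^ 2)⁻¹
        ≤ ∫ τ : ℝ, ‖D τ‖ ^ 2 * M τ := by
          refine integral_mono hint1 hintM fun τ => ?_
          exact mul_le_mul_of_nonneg_left (hG τ) (by positivity)
      _ = (2 * π / δ) * (∫ τ : ℝ, ‖D τ‖ ^ 2 *
            Set.indicator (Set.Icc (T / 2) (3 * T)) (fun _ => (1 : ℝ)) τ) +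
          (120 / (δ * T)) * ∫ τ : ℝ, ‖D τ‖ ^ 2 * (1 + τ ^ 2 / T ^ 2)⁻¹ := by
          rw [← integral_const_mul, ← integral_const_mul, ← integral_add (hpieceA.const_mul _)
            (hpieceB.const_mul _)]
          refine integral_congr_ae (Eventually.of_forall fun τ => ?_)
          simp only [hM]; ring
      _ ≤ (2 * π / δ) * (∫ τ in (T / 2)..(3 * T), ‖D τ‖ ^ 2) +
          (120 / (δ * T)) * (π * ∑ n ∈ Finset.Icc 1 N, (T + 3 * n) * ‖a n‖ ^ 2) := by
          rw [hA]
          gcongr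
          exact integral_norm_sq_dpoly_cauchy_le a N hT
  -- `(120/(δT)) π Σ (T + 3n)|a_n|² = (120π/δ) Σ (1 + 3n/T)|a_n|² ≤ (360π/δ) Σ (1+n/T)|a_n|²`
  have hS : (120 / (δ * T)) * (π * ∑ n ∈ Finset.Icc 1 N, (T + 3 * n) * ‖a n‖ ^ 2) ≤
      (360 * π / δ) * ∑ n ∈ Finset.Icc 1 N, (1 + n / T) * ‖a n‖ ^ 2 := by
    rw [← mul_assoc, Finset.mul_sum, Finset.mul_sum]
    refine Finset.sum_le_sum fun n _ => ?_
    have hn0 : (0 : ℝ) ≤ n := Nat.cast_nonneg n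
    have hx : 0 ≤ ‖a n‖ ^ 2 := sq_nonneg _
    have e : 120 / (δ * T) * π * ((T + 3 * n) * ‖a n‖ ^ 2) =
        (120 * π / δ) * ((1 + 3 * n / T) * ‖a n‖ ^ 2) := by
      field_simp
    rw [e]
    have h3 : (120 * π / δ) * (1 + 3 * (n : ℝ) / T) ≤ (360 * π / δ) * (1 + n / T) := by
      rw [show (360 * π / δ) * (1 + (n : ℝ) / T) = (120 * π / δ) * (3 + 3 * n / T) by ring]
      gcongr
      norm_num
    calc 120 * π / δ * ((1 + 3 * ↑n / T) * ‖a n‖ ^ 2) = (120 * π / δ * (1 + 3 * ↑n / T)) * ‖a n‖ ^ 2 := by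
          ring
      _ ≤ (360 * π / δ * (1 + ↑n / T)) * ‖a n‖ ^ 2 := mul_le_mul_of_nonneg_right h3 hx
      _ = 360 * π / δ * ((1 + ↑n / T) * ‖a n‖ ^ 2) := by ring
  have hI0 : 0 ≤ ∫ τ in (T / 2)..(3 * T), ‖D τ‖ ^ 2 :=
    intervalIntegral.integral_nonneg (by linarith) fun τ _ => by positivity
  have hsum0 : 0 ≤ ∑ n ∈ Finset.Icc 1 N, (1 + n / T) * ‖a n‖ ^ 2 :=
    Finset.sum_nonneg fun n _ => by positivity
  have hπ : π ≤ 4 := by linarith [Real.pi_lt_four]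
  calc c / (2 * π) * ∫ τ : ℝ, ‖D τ‖ ^ 2 * ∑ t ∈ 𝒯, (1 + (τ - t) ^ 2)⁻¹
      ≤ c / (2 * π) * ((2 * π / δ) * (∫ τ in (T / 2)..(3 * T), ‖D τ‖ ^ 2) +
          (360 * π / δ) * ∑ n ∈ Finset.Icc 1 N, (1 + n / T) * ‖a n‖ ^ 2) :=
        mul_le_mul_of_nonneg_left (hI.trans (by linarith [hS])) (by positivity)
    _ = c * δ⁻¹ * ((∫ τ in (T / 2)..(3 * T), ‖D τ‖ ^ 2) +
          180 * ∑ n ∈ Finset.Icc 1 N, (1 + n / T) * ‖a n‖ ^ 2) := by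
        field_simp
        ring
    _ ≤ 180 * c * δ⁻¹ * ((∫ τ in (T / 2)..(3 * T), ‖D τ‖ ^ 2) +
          ∑ n ∈ Finset.Icc 1 N, (1 + n / T) * ‖a n‖ ^ 2) := by
        have hcδ : 0 ≤ c * δ⁻¹ := by positivity
        nlinarith [mul_nonneg hcδ hI0, mul_nonneg hcδ hsum0]

/-- **Proposition 5.4 with point-dependent weights, `∃ C` form** (the registered stub
`stub_weighted_dmv_integral` of the Conrey–Iwaniec Proposition 8.1 line; the Dirichlet polynomial
written out). [cite: ConreyIwaniec2002, Proposition 5.4 (5.19)] -/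
theorem exists_weighted_discreteMeanValue_integral :
    ∃ C : ℝ, 0 < C ∧
    ∀ (N : ℕ) (a : ℕ → ℂ) (T δ c : ℝ) (𝒯 : Finset ℝ) (ω : ℝ → ℝ → ℂ),
      2 ≤ T → 0 < δ → δ ≤ 1 → 0 ≤ c →
      (∀ t ∈ 𝒯, T ≤ t ∧ t ≤ 2 * T) → (∀ t ∈ 𝒯, ∀ t' ∈ 𝒯, t ≠ t' → δ ≤ |t - t'|) →
      (∀ t ∈ 𝒯, Differentiable ℝ (ω t) ∧ Integrable (ω t) ∧ Integrable (deriv (ω t)) ∧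
        MemLp (ω t) 2 ∧ MemLp (deriv (ω t)) 2 ∧
        (∫ y : ℝ, ‖ω t y‖ ^ 2) + (∫ y : ℝ, ‖deriv (ω t) y‖ ^ 2) ≤ c) →
      ∑ t ∈ 𝒯, ‖∑ n ∈ Finset.Icc 1 N, a n * ω t (Real.log n) * (n : ℂ) ^ (-((t : ℂ) * I))‖ ^ 2 ≤
        C * c * δ⁻¹ *
          ((∫ τ in (T / 2)..(3 * T), ‖∑ n ∈ Finset.Icc 1 N, a n * (n : ℂ) ^ (-((τ : ℂ) * I))‖ ^ 2) +
            ∑ n ∈ Finset.Icc 1 N, (1 + n / T) * ‖a n‖ ^ 2) :=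
  ⟨180, by norm_num, fun N a T δ c 𝒯 ω hT hδ hδ1 hc hmem hsep hω =>
    weighted_discreteMeanValue_integral N a 𝒯 ω hT hδ hδ1 hc hmem hsep hω⟩

end WeightedMeanValue

end Literature.NumberTheory.LFunctions

end
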